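import Mathlib

/-!
# THE EISENSTEIN FIELD `ℚ(ζ₃) = ℚ(√−3)` AND THE PRIME `3`: the elementary inputs of a concrete TAME ramified place
(T5EisensteinField)

The tame twin of T5GaussianField: the field `L₃ := ℚ(ζ₃)` (Mathlib's `CyclotomicField 3 ℚ`) with its primitive cube
root of unity `ω` (`ω² + ω + 1 = 0`, `ω³ = 1`, `(1 − ω)² = −3ω`, `ω` integral, `[L₃ : ℚ] = 2`), the place `v₃` of `ℚ`
at `3`, and the 3-adic fact that `X² + X + 1` has NO root in `ℚ₃` (a root would be a 3-adic integer; no root in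
`ℤ/9`) transported to `ℚ_{v₃}`. The concrete place is assembled in T5EisensteinPlace (residue characteristic `3`:
the TAME case of the chain, `f(η_v) = 1`).

No axiom beyond the standard trio; nothing of the scored record changes.
§8(d): uses an L-value-free non-vanishing device: NO.
-/

namespace Summit.Ventures.HodgeRepro2.T5EisensteinField

open IsDedekindDomain HeightOneSpectrum NumberField

/-! ### The field `ℚ(ζ₃)` -/

/-- `L₃ := ℚ(ζ₃)`, Mathlib's `CyclotomicField 3 ℚ`. -/
abbrev L₃ : Type := CyclotomicField 3 ℚ

/-- `L₃` is the cyclotomic extension of `ℚ` of order `3` (Mathlib's instance, stated for the `ℚ`-algebra structure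
`DivisionRing.toRatAlgebra` that every other statement about `L₃` uses; `IsCyclotomicExtension` is a `Prop`). -/
theorem isCyclotomic : IsCyclotomicExtension {3} ℚ L₃ := CyclotomicField.isCyclotomicExtension 3 ℚ

/-- The primitive cube root of unity `ω` of `L₃`. -/
noncomputable def ω : L₃ :=
  haveI := isCyclotomic
  IsCyclotomicExtension.zeta 3 ℚ L₃

/-- `ω` is a primitive cube root of unity. -/
theorem isPrimitiveRoot_omega : IsPrimitiveRoot ω 3 :=
  haveI := isCyclotomic
  IsCyclotomicExtension.zeta_spec 3 ℚ L₃

/-- `ω³ = 1`. -/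
theorem omega_pow_three : ω ^ 3 = 1 := isPrimitiveRoot_omega.pow_eq_one

/-- `ω² + ω + 1 = 0`. -/
theorem omega_sq_add_omega_add_one : ω ^ 2 + ω + 1 = 0 := by
  have h := isPrimitiveRoot_omega.geom_sum_eq_zero (by norm_num)
  simp only [Finset.sum_range_succ, Finset.sum_range_zero, pow_zero, pow_one, zero_add] at h
  linear_combination h

/-- `ω · ω² = 1`: `ω` is a unit. -/
theorem omega_mul_omega_sq : ω * ω ^ 2 = 1 := by
  rw [← pow_succ', omega_pow_three]

/-- `(1 − ω)² = −3 ω`. -/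
theorem one_sub_omega_sq : (1 - ω) ^ 2 = -(3 * ω) := by
  linear_combination omega_sq_add_omega_add_one

/-- `(2ω + 1)² = −3`. -/
theorem two_mul_omega_add_one_sq : (2 * ω + 1) ^ 2 = -3 := by
  linear_combination 4 * omega_sq_add_omega_add_one

/-- `[ℚ(ζ₃) : ℚ] = 2`. -/
theorem finrank_eq_two : Module.finrank ℚ L₃ = 2 := by
  haveI := isCyclotomic
  rw [IsCyclotomicExtension.finrank L₃ (Polynomial.cyclotomic.irreducible_rat (by norm_num : 0 < 3))]
  decide

/-- `ω` is integral over `ℤ`. -/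
theorem omega_isIntegral : IsIntegral ℤ ω := isPrimitiveRoot_omega.isIntegral (by norm_num)

/-- `ω` as an element of `𝓞 L₃`. -/
noncomputable def ωO : NumberField.RingOfIntegers L₃ := ⟨ω, omega_isIntegral⟩

/-- `ωO` is `ω`. -/
@[simp] theorem coe_omegaO : (ωO : L₃) = ω := rfl

/-- `(1 − ω)² = −3 ω` in `𝓞 L₃`. -/
theorem one_sub_omegaO_sq : (1 - ωO) ^ 2 = -(3 * ωO) := by
  apply NumberField.RingOfIntegers.ext
  push_cast
  exact one_sub_omega_sq

/-- `ω · ω² = 1` in `𝓞 L₃`. -/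
theorem omegaO_mul_omegaO_sq : ωO * ωO ^ 2 = 1 := by
  apply NumberField.RingOfIntegers.ext
  push_cast
  exact omega_mul_omega_sq

/-! ### The prime `3` of `ℚ` -/

/-- The finite place `v₃` of `ℚ` at the prime `3`, as a height-one prime of `𝓞 ℚ`. -/
noncomputable def v₃ : HeightOneSpectrum (NumberField.RingOfIntegers ℚ) :=
  (Rat.HeightOneSpectrum.primesEquiv (R := NumberField.RingOfIntegers ℚ)).symm ⟨3, Nat.prime_three⟩

/-- `primesEquiv v₃ = 3`. -/
theorem primesEquiv_v₃ :
    Rat.HeightOneSpectrum.primesEquiv (R := NumberField.RingOfIntegers ℚ) v₃ = ⟨3, Nat.prime_three⟩ :=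
  Equiv.apply_symm_apply _ _

/-- `(primesEquiv v₃ : ℕ) = 3`. -/
theorem primesEquiv_v₃_val :
    ((Rat.HeightOneSpectrum.primesEquiv (R := NumberField.RingOfIntegers ℚ) v₃ : Nat.Primes) : ℕ) = 3 := by
  rw [primesEquiv_v₃]

/-! ### `X² + X + 1` has no root in `ℚ₃` -/

/-- `X² + X + 1` has no root in `ℚ_p` for `p = 3`: a root is a 3-adic integer (ultrametric), and `X² + X + 1` has no
root in `ℤ/9`. -/
theorem not_exists_root_padic (p : ℕ) [hp : Fact p.Prime] (h3 : p = 3) :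
    ¬ ∃ y : ℚ_[p], y ^ 2 + y + 1 = 0 := by
  subst h3
  rintro ⟨y, hy⟩
  have hnorm : ‖y‖ ≤ 1 := by
    by_contra hlt
    have hlt' : 1 < ‖y‖ := lt_of_not_ge hlt
    have hsq : y ^ 2 = -(y + 1) := by linear_combination hy
    have h1 : ‖y‖ ^ 2 = ‖y + 1‖ := by rw [← norm_pow, hsq, norm_neg]
    have h2 : ‖y + 1‖ ≤ max ‖y‖ ‖(1 : ℚ_[3])‖ := Padic.nonarchimedean y 1
    rw [norm_one, max_eq_left hlt'.le] at h2
    nlinarith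
  set z : ℤ_[3] := ⟨y, hnorm⟩ with hz
  have hz2 : z ^ 2 + z + 1 = 0 := by
    apply Subtype.ext
    simp [hz, hy]
  have hmod := congrArg (PadicInt.toZModPow 2) hz2
  rw [map_add, map_add, map_pow, map_one, map_zero] at hmod
  have key : ∀ a : ZMod (3 ^ 2), a ^ 2 + a + 1 ≠ 0 := by decide
  exact key _ hmod

/-- `X² + X + 1` has no root in `ℚ_{v₃}` (transport through `adicCompletion.padicEquiv`). -/
theorem not_exists_root : ¬ ∃ y : v₃.adicCompletion ℚ, y ^ 2 + y + 1 = 0 := by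
  rintro ⟨y, hy⟩
  haveI : Fact (Nat.Prime ((Rat.HeightOneSpectrum.primesEquiv (R := NumberField.RingOfIntegers ℚ) v₃ :
      Nat.Primes) : ℕ)) := ⟨(Rat.HeightOneSpectrum.primesEquiv v₃).2⟩
  apply not_exists_root_padic _ primesEquiv_v₃_val
  refine ⟨Rat.HeightOneSpectrum.adicCompletion.padicEquiv v₃ y, ?_⟩
  rw [← map_one (Rat.HeightOneSpectrum.adicCompletion.padicEquiv v₃), ← map_pow, ← map_add, ← map_add, hy, map_zero]

end Summit.Ventures.HodgeRepro2.T5EisensteinField
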